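import Summits.QuantumFields.YangMills.Theorems.FlatTubeReductionDressedOneOrbitRatePrelim
import Summits.QuantumFields.YangMills.Theorems.FlatTubeReductionDressedOneOrbitRateWindow
import Summits.QuantumFields.YangMills.Theorems.LuscherReductionTwistedTraceScalingOneSiteInner
import Summits.QuantumFields.YangMills.Theorems.FemtoCutoffLadderFixedLatticeLawInnerRateCopies
import HarnessLib

/-!
# ★★★ THE DRESSED ONE-SITE NO-INTRUDER WITH RATE ⟸ (EM): `BORateBricksD.hDS` on a window of radius `O(B^{-1/6})`, every level, modulo the one-site sub-target `OneSiteEigenMoments`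
# (route `FlatTubeReduction`, crux K1 `NearFlatRatioLaw` stmt-QuantumFields-24720; seat `ym-line-ftr-p1` g10; R2b1 RECORD rung — no summit statement is proved here)

★★★ `dressedOneOrbitRate_of_eigenMoments`: assume (EM) (`OneSiteEigenMoments`, p658355).  Let `W_B` be physical one-site weights (gauge AND twist invariant, `0 ≤ W ≤ C_W`) with
`|W_B(u)² − 1| ≤ κ_W·orbitDist(u)²` on the one-orbit window `{orbitDist < δ(B)}`, where eventually `0 < δ ≤ 1/2` and `κ_W·δ² ≤ A·λ_b(B)` (i.e. `δ = O(B^{-1/6})`, the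
«ratepack-v2» core).  Then for every level `k` there are `C, B₀` with: for `B ≥ B₀`, every `(k+1)`-family `G` of bounded measurable gauge-invariant one-site amplitudes supported in
the window has `a ≠ 0` with  `⟨G_aW, K_B G_aW⟩·μ₀ ≤ e^{Cλ_b²}·μ_k·μ₀·‖G_a‖²`  (norm UNDRESSED; no Gram condition needed) — literally the shape of the brick field `hDS` at the
one-site coupling.  PROOF = crux ONE's eight-copies calculus around the CLUSTER ABSORPTION lemma: `cluster_gap` (index `n`, `μ_n(1+2Aλ) ≤ μ_k`, `μ_k − μ_n ≤ C_gλμ_k`); the exact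
dominating eigenfamily `e₀…e_n` at coupling `B` (`exists_isPhys_eigenfamily_dominating_of_pos`); (EM) at `m = n`; `Ψᵢ := twistSum Gᵢ` (physical), coefficients `a ≠ 0` with
`Ψ_aW ⊥ e_{<k}` (`exists_coeff_orthogonal`); `qform_dressed_le_of_cluster` on the symmetrised window with `V = 8κ_W(n+1)Sλ²`, `w² = (n+1)κ_Wδ²·V` (`dressed_moment_form_le`,
`dressed_overlap_le`), gap condition from `κ_Wδ² ≤ Aλ`; undo the copies (`l2_twistSum`, `twistSum_mul_of_isPhys`, `abs_qform_twistSum_sub_le`, `crossBound_eventually_small_sq`).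
HONEST FRAMING: conditional on the OPEN one-site sub-target (EM); the fibre bricks of the rate twin stay OPEN; femto rung R2b1 (RECORD label); not infinite volume, not a gap,
not Clay.  No defs, no named facts, no `sorry`.
-/

set_option autoImplicit false

noncomputable section

open MeasureTheory Filter Topology Real
open scoped BigOperators
open Literature.MathematicalPhysics.QuantumFieldTheory
open Literature.MathematicalPhysics.QuantumLattice

namespace Summit.QuantumFields.YangMills.Theorems.FemtoTransferGap.RateTube

open Summit.QuantumFields.YangMills.Theorems.FemtoTransferGap
open Summit.QuantumFields.YangMills.Theorems.FemtoCutoffLadder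
open Summit.QuantumFields.YangMills.Theorems.FemtoTransferGap.TwoLattice.ConstTube (l2_self_eq_integral_sq)

set_option maxHeartbeats 400000 in
/-- ★★★ **THE DRESSED ONE-SITE NO-INTRUDER WITH RATE, modulo (EM)** — see the module docstring.  The conclusion is the brick field `BORateBricksD.hDS` at the one-site coupling `B`
(every level `k`), for physical weights with `|W² − 1| ≤ κ_W·orbitDist²` on a window of radius `δ(B)` with `κ_Wδ² ≤ Aλ_b(B)`. [cite: Luscher1983, §2–§3] [cite: ReedSimonIV1978, Thm. XIII.1] -/
theorem dressedOneOrbitRate_of_eigenMoments (hEM : OneSiteEigenMoments) (k : ℕ) {δ : ℝ → ℝ} {W : ℝ → (GaugeConfig 3 1 SU2 → ℝ)} {κW CW A : ℝ}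
    (hκW : 0 ≤ κW) (hA : 0 ≤ A) (hW : ∀ B, IsPhys (W B)) (hWb : ∀ B u, |W B u| ≤ CW) (hW0 : ∀ B u, 0 ≤ W B u)
    (hWsq : ∀ B u, orbitDist u < δ B → |W B u ^ 2 - 1| ≤ κW * orbitDist u ^ 2)
    (hδ : ∃ B1 : ℝ, ∀ B : ℝ, B1 ≤ B → 0 < δ B ∧ δ B ≤ 1 / 2 ∧ κW * δ B ^ 2 ≤ A * bareLambda B) :
    ∃ C B₀ : ℝ, ∀ B : ℝ, B₀ ≤ B → ∀ G : Fin (k + 1) → (GaugeConfig 3 1 SU2 → ℝ),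
      (∀ i, Measurable (G i)) → (∀ i, ∃ C' : ℝ, ∀ u, |G i u| ≤ C') →
      (∀ i (g : Site 3 1 → SU2) (u : GaugeConfig 3 1 SU2), G i (gaugeTransform g u) = G i u) →
      (∀ i u, G i u ≠ 0 → orbitDist u < δ B) →
        ∃ a : Fin (k + 1) → ℝ, a ≠ 0 ∧
          qform su2Rep B (fun u => (∑ i, a i * G i u) * W B u) (fun u => (∑ i, a i * G i u) * W B u) * levelValue su2Rep 1 B 0 ≤
            Real.exp (C * bareLambda B ^ 2) * levelValue su2Rep 1 B k * levelValue su2Rep 1 B 0 *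
              l2 (fun u => ∑ i, a i * G i u) (fun u => ∑ i, a i * G i u) := by
  classical
  -- the cluster index and the one-site constants
  obtain ⟨n, hkn1, Cg, Bg, hCg0, hgap⟩ := cluster_gap k hA
  have hkn : k ≤ n := (Nat.le_succ k).trans hkn1
  obtain ⟨S, BS, hS0, hEMn⟩ := hEM n
  obtain ⟨B1, hδ1⟩ := hδ
  obtain ⟨Bc, hcross⟩ := crossBound_eventually_small_sq (L := 1) (m := 1 / 2) (by norm_num) one_pos
  have hCW0 : 0 ≤ CW := (abs_nonneg _).trans (hWb 0 1)
  -- the constants: `V = cV λ²`, `w² ≤ cw2 λ²`, final `C`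
  set cV : ℝ := 8 * κW * (n + 1) * S with hcV
  have hcV0 : 0 ≤ cV := by positivity
  set cw2 : ℝ := (n + 1) * A * cV with hcw2
  have hcw20 : 0 ≤ cw2 := by positivity
  set C : ℝ := 2 * cV + Cg * (2 * Real.sqrt cw2 + cw2) + CW ^ 2 / 2 with hCdef
  refine ⟨C, max (max Bg BS) (max (max B1 Bc) 1), fun B hB G hGm hGb hGg hGs => ?_⟩
  have hBg : Bg ≤ B := ((le_max_left _ _).trans (le_max_left _ _)).trans hB
  have hBS : BS ≤ B := ((le_max_right _ _).trans (le_max_left _ _)).trans hB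
  have hB1 : B1 ≤ B := (((le_max_left _ _).trans (le_max_left _ _)).trans (le_max_right _ _)).trans hB
  have hBc : Bc ≤ B := (((le_max_right _ _).trans (le_max_left _ _)).trans (le_max_right _ _)).trans hB
  have hBone : 1 ≤ B := ((le_max_right _ _).trans (le_max_right _ _)).trans hB
  have hB0 : 0 < B := by linarith
  obtain ⟨hμ0, hμk2, hμn0, hμnk, hμkn, hlam0, hlam1⟩ := hgap B hBg
  obtain ⟨hδ0, hδhalf, hκδ⟩ := hδ1 B hB1
  set lam : ℝ := bareLambda B with hlam
  set μ0 : ℝ := levelValue su2Rep 1 B 0 with hμ0def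
  set μk : ℝ := levelValue su2Rep 1 B k with hμkdef
  set μn : ℝ := levelValue su2Rep 1 B n with hμndef
  have hμkpos : 0 < μk := by linarith
  have hμn_le_k : μn ≤ μk := by
    have h1 : μn * 1 ≤ μn * (1 + 2 * A * lam) := mul_le_mul_of_nonneg_left (by nlinarith [mul_nonneg hA hlam0.le]) hμn0
    linarith [hμnk]
  -- one-site scales
  have hLδ : ((1 : ℕ) : ℝ) * δ B < 2 := by rw [Nat.cast_one, one_mul]; linarith
  have hLm : ((1 : ℕ) : ℝ) * (δ B + 1 / 2) < 2 := by rw [Nat.cast_one, one_mul]; linarith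
  have e1B : ((1 : ℕ) : ℝ) ^ 3 * B = B := by rw [Nat.cast_one, one_pow, one_mul]
  -- the exact dominating eigenfamily `e₀ … e_n` at coupling `B`
  obtain ⟨e, he, hon, heig, hdom⟩ := exists_isPhys_eigenfamily_dominating_of_pos (L := 1) hB0 n
  -- (EM) for the eigenfamily: one-orbit second moments `≤ Sλ²`
  have hMom : ∀ i : Fin (n + 1), ∫ u, (if orbitDist u < 1 / 2 then orbitDist u ^ 2 else 0) * e i u ^ 2 ∂configMeasure SU2 1 ≤ S * lam ^ 2 := by
    intro i
    have h := hEMn B hBS (e i) (he i) ⟨i, Nat.lt_succ_iff.mp i.isLt, heig i⟩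
    have h1 : l2 (e i) (e i) = 1 := by rw [hon]; simp
    rw [h1, mul_one] at h
    exact h
  -- the physical family `Ψᵢ = twistSum Gᵢ` and the dressed family `Ψᵢ·W`
  choose CG hCG using hGb
  set Ψ : Fin (k + 1) → GaugeConfig 3 1 SU2 → ℝ := fun i => twistSum (G i) with hΨdef
  have hΨ : ∀ i, IsPhys (Ψ i) := fun i => isPhys_twistSum (hGm i) ⟨CG i, hCG i⟩ (hGg i)
  set W' : GaugeConfig 3 1 SU2 → ℝ := W B with hW'def
  have hW' : IsPhys W' := hW B
  have hF : ∀ i, IsPhys (fun u => Ψ i u * W' u) := fun i => OpPlat.isPhys_mul (hΨ i) hW'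
  -- coefficients: `Ψ_a W ⊥ e_{<k}`
  have hkn' : k ≤ n + 1 := hkn.trans (Nat.le_succ n)
  obtain ⟨a, ha, hperp0⟩ := exists_coeff_orthogonal (fun i => fun u => Ψ i u * W' u) hF (fun j : Fin k => e ⟨j, lt_of_lt_of_le j.isLt hkn'⟩)
    (fun j => he _)
  refine ⟨a, ha, ?_⟩
  -- combinations
  have hGam : Measurable (fun u => ∑ i, a i * G i u) := Finset.measurable_sum _ fun i _ => (hGm i).const_mul _
  have hGab : ∀ u, |∑ i, a i * G i u| ≤ ∑ i, |a i| * CG i := fun u =>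
    (Finset.abs_sum_le_sum_abs _ _).trans (Finset.sum_le_sum fun i _ => by rw [abs_mul]; exact mul_le_mul_of_nonneg_left (hCG i u) (abs_nonneg _))
  have hGag : ∀ (g : Site 3 1 → SU2) u, (∑ i, a i * G i (gaugeTransform g u)) = ∑ i, a i * G i u := fun g u =>
    Finset.sum_congr rfl fun i _ => by rw [hGg]
  have hGas : ∀ u, (∑ i, a i * G i u) ≠ 0 → orbitDist u < δ B := fun u h => by
    by_contra hlt
    exact h (Finset.sum_eq_zero fun i _ => by
      have : G i u = 0 := by by_contra hi; exact hlt (hGs i u hi)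
      rw [this, mul_zero])
  set Ψa : GaugeConfig 3 1 SU2 → ℝ := fun u => ∑ i, a i * Ψ i u with hΨadef
  have hΨa : IsPhys Ψa := isPhys_sum_mul_lat Finset.univ Ψ hΨ a
  have hΨa_eq : Ψa = twistSum (fun u => ∑ i, a i * G i u) := by rw [twistSum_sum_mul]
  -- the symmetrised window and the absorption lemma's hypotheses
  set Sset : Set (GaugeConfig 3 1 SU2) := {u | twistSum (fun v => if orbitDist v < δ B then (1 : ℝ) else 0) u ≠ 0} with hSset
  obtain ⟨hSm, hSg, hSz⟩ := twistWindow_set_props (L := 1) (δ B)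
  have hΨaS : ∀ u, Ψa u ≠ 0 → u ∈ Sset := by
    intro u hu
    rw [hΨa_eq] at hu
    obtain ⟨z, -, hz⟩ := Finset.exists_ne_zero_of_sum_ne_zero hu
    exact (twistWindow_ne_zero_iff (δ B) u).mpr ⟨z, hGas _ hz⟩
  set κbar : ℝ := κW * δ B ^ 2 with hκbar
  have hκbar0 : 0 ≤ κbar := by positivity
  have hκS : ∀ u ∈ Sset, |W' u ^ 2 - 1| ≤ κbar := by
    intro u hu
    obtain ⟨z, hz⟩ := (twistWindow_ne_zero_iff (δ B) u).mp hu
    rw [← TT.twist3_eq_of_isPhys hW' z u]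
    exact (hWsq B _ hz).trans (mul_le_mul_of_nonneg_left (pow_le_pow_left₀ (orbitDist_nonneg _) hz.le 2) hκW)
  have hV := fun c : Fin (n + 1) → ℝ => dressed_moment_form_le hW' hκW hδhalf (hWsq B) he hMom c
  have hwO := dressed_overlap_le hW' (hW0 B) hκW hδhalf (hWsq B) he hMom
  -- `V = cV λ²`, `w = √cw2 · λ`
  set V : ℝ := cV * lam ^ 2 with hVdef
  have hV0 : 0 ≤ V := by positivity
  have hV' : ∀ c : Fin (n + 1) → ℝ, ∫ u, Sset.indicator (fun u => |W' u ^ 2 - 1|) u * (∑ i, c i * e i u) ^ 2 ∂configMeasure SU2 1 ≤ V * ∑ i, c i ^ 2 := by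
    intro c
    refine (hV c).trans (le_of_eq ?_)
    rw [hVdef, hcV]; ring
  set w : ℝ := Real.sqrt cw2 * lam with hwdef
  have hw0 : 0 ≤ w := by positivity
  have hw2 : ∑ i : Fin (n + 1), l2 (fun u => Sset.indicator 1 u * (W' u - 1) * e i u) (fun u => Sset.indicator 1 u * (W' u - 1) * e i u) ≤ w ^ 2 := by
    refine hwO.trans ?_
    have h1 : (n + 1) * (κW * δ B ^ 2) * (8 * κW * (n + 1) * (S * lam ^ 2)) ≤ (n + 1) * (A * lam) * (8 * κW * (n + 1) * (S * lam ^ 2)) :=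
      mul_le_mul_of_nonneg_right (mul_le_mul_of_nonneg_left hκδ (by positivity)) (by positivity)
    have h2 : (n + 1) * (A * lam) * (8 * κW * (n + 1) * (S * lam ^ 2)) = cw2 * lam ^ 3 := by rw [hcw2, hcV]; ring
    have h3 : cw2 * lam ^ 3 ≤ cw2 * lam ^ 2 := by
      refine mul_le_mul_of_nonneg_left ?_ hcw20
      calc lam ^ 3 = lam ^ 2 * lam := by ring
        _ ≤ lam ^ 2 * 1 := mul_le_mul_of_nonneg_left hlam1 (sq_nonneg lam)
        _ = lam ^ 2 := mul_one _
    have h4 : w ^ 2 = cw2 * lam ^ 2 := by rw [hwdef, mul_pow, Real.sq_sqrt hcw20]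
    linarith [h1, h2, h3, h4]
  -- gap condition: `2κ̄μ_n ≤ μ_k − μ_n` from `κ̄ ≤ Aλ` and `μ_n(1+2Aλ) ≤ μ_k`
  have hgapc : 2 * κbar * μn ≤ μk - μn := by
    have : 2 * κbar * μn ≤ 2 * (A * lam) * μn := by nlinarith [hκδ, hμn0]
    nlinarith [hμnk]
  -- orthogonality `Ψ_a W ⊥ e_{<k}`
  have hcombF : (fun u => W' u * Ψa u) = fun u => ∑ i, a i * (Ψ i u * W' u) := by
    funext u; simp only [hΨadef]; rw [Finset.mul_sum]; exact Finset.sum_congr rfl fun i _ => by ring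
  have hperp : ∀ i : Fin (n + 1), (i : ℕ) < k → l2 (fun u => W' u * Ψa u) (e i) = 0 := by
    intro i hi
    rw [hcombF]
    have h := hperp0 ⟨i, hi⟩
    have e2 : (⟨((⟨i, hi⟩ : Fin k) : ℕ), lt_of_lt_of_le ((⟨i, hi⟩ : Fin k)).isLt hkn'⟩ : Fin (n + 1)) = i := Fin.ext rfl
    rw [e2] at h
    exact h
  -- ★ CLUSTER ABSORPTION
  have habs := qform_dressed_le_of_cluster (L := 1) hB0 he hon heig hdom hkn hW'.measurable (hWb B) hW'.gaugeInv hW'.zeroFlux hSm hSg hSz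
    hκbar0 hκS hV0 hV' hw0 hw2 hgapc hΨa hΨaS hperp
  -- undo the eight copies
  have hl2Ψ : l2 Ψa Ψa = 8 * l2 (fun u => ∑ i, a i * G i u) (fun u => ∑ i, a i * G i u) := by
    rw [hΨa_eq]; exact l2_twistSum hGam hGab hLδ hGas
  have hGWm : Measurable (fun u => (∑ i, a i * G i u) * W' u) := hGam.mul hW'.measurable
  have hGWb : ∀ u, |(∑ i, a i * G i u) * W' u| ≤ (∑ i, |a i| * CG i) * CW := fun u => by
    rw [abs_mul]; exact mul_le_mul (hGab u) (hWb B u) (abs_nonneg _) ((abs_nonneg _).trans (hGab u))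
  have hGWs : ∀ u, (∑ i, a i * G i u) * W' u ≠ 0 → orbitDist u < δ B := fun u h => hGas u (left_ne_zero_of_mul h)
  have htw : (fun u => W' u * Ψa u) = twistSum (fun u => (∑ i, a i * G i u) * W' u) := by
    funext u; rw [twistSum_mul_of_isPhys _ hW' u, ← hΨa_eq]; ring
  have hq8 := abs_qform_twistSum_sub_le hB0.le hGWm hGWb (by norm_num : (0 : ℝ) ≤ 1 / 2) hLm hGWs
  rw [← htw] at hq8
  have hl2GW : l2 (fun u => (∑ i, a i * G i u) * W' u) (fun u => (∑ i, a i * G i u) * W' u) ≤ CW ^ 2 * l2 (fun u => ∑ i, a i * G i u) (fun u => ∑ i, a i * G i u) := by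
    rw [l2_self_eq_integral_sq, l2_self_eq_integral_sq, ← integral_const_mul]
    refine integral_mono ?_ ?_ fun u => ?_
    · exact integrable_of_measurable_abs_le _ (hGWm.pow_const 2) (C := ((∑ i, |a i| * CG i) * CW) ^ 2) fun u => by
        rw [abs_pow]; exact pow_le_pow_left₀ (abs_nonneg _) (hGWb u) 2
    · exact (integrable_of_measurable_abs_le _ (hGam.pow_const 2) (C := (∑ i, |a i| * CG i) ^ 2) fun u => by
        rw [abs_pow]; exact pow_le_pow_left₀ (abs_nonneg _) (hGab u) 2).const_mul _
    · dsimp only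
      have h1 : W' u ^ 2 ≤ CW ^ 2 := by
        have h2 : |W' u| ≤ CW := hWb B u
        rw [← sq_abs]; exact pow_le_pow_left₀ (abs_nonneg _) h2 2
      rw [mul_pow, mul_comm]
      exact mul_le_mul_of_nonneg_right h1 (sq_nonneg _)
  -- the cross terms are below `λ²μ₀/28`
  have hcb : 28 * crossBound 1 B (1 / 2) ≤ lam ^ 2 * μ0 := by
    have h := (hcross B hBc).trans (mul_le_mul_of_nonneg_left (levelValue_zero_ge_uniform (L := 1) hBone) (by positivity))
    rw [e1B, one_mul] at h
    exact h
  have hcb0 : 0 ≤ crossBound 1 B (1 / 2) := (crossBound_pos (L := 1) B (1 / 2)).le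
  -- endgame
  set N : ℝ := l2 (fun u => ∑ i, a i * G i u) (fun u => ∑ i, a i * G i u) with hNdef
  have hN0 : 0 ≤ N := l2_self_nonneg_lat _
  set q : ℝ := qform su2Rep B (fun u => (∑ i, a i * G i u) * W' u) (fun u => (∑ i, a i * G i u) * W' u) with hqdef
  have hΛ : qform su2Rep B (fun u => W' u * Ψa u) (fun u => W' u * Ψa u) ≤ (μk + 2 * μn * V + (μk - μn) * (2 * w + w ^ 2)) * (8 * N) := by
    rw [← hl2Ψ]; exact habs
  have h8q : 8 * q ≤ (μk + 2 * μn * V + (μk - μn) * (2 * w + w ^ 2)) * (8 * N) + 56 * (crossBound 1 B (1 / 2) * (CW ^ 2 * N)) := by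
    have h1 := (abs_le.mp hq8).1
    have h2 : 56 * (crossBound 1 B (1 / 2) * l2 (fun u => (∑ i, a i * G i u) * W' u) (fun u => (∑ i, a i * G i u) * W' u)) ≤
        56 * (crossBound 1 B (1 / 2) * (CW ^ 2 * N)) := by
      have := mul_le_mul_of_nonneg_left hl2GW hcb0; linarith
    linarith [hΛ, h1, h2]
  -- bound every term by a multiple of `λ² μ_k N`
  have hw_le : w ≤ Real.sqrt cw2 * lam := le_rfl
  have hterm1 : 2 * μn * V ≤ 2 * cV * lam ^ 2 * μk := by
    have h1 : μn * V ≤ μk * V := mul_le_mul_of_nonneg_right hμn_le_k hV0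
    have e1 : 2 * cV * lam ^ 2 * μk = 2 * (μk * V) := by rw [hVdef]; ring
    rw [e1]; linarith
  have hterm2 : (μk - μn) * (2 * w + w ^ 2) ≤ Cg * (2 * Real.sqrt cw2 + cw2) * lam ^ 2 * μk := by
    have hlamsq : lam ^ 2 ≤ lam := by
      calc lam ^ 2 = lam * lam := sq lam
        _ ≤ lam * 1 := mul_le_mul_of_nonneg_left hlam1 hlam0.le
        _ = lam := mul_one lam
    have hw2' : w ^ 2 = cw2 * lam ^ 2 := by rw [hwdef, mul_pow, Real.sq_sqrt hcw20]
    have hl2 : cw2 * lam ^ 2 ≤ cw2 * lam := mul_le_mul_of_nonneg_left hlamsq hcw20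
    have h2w : 2 * w + w ^ 2 ≤ (2 * Real.sqrt cw2 + cw2) * lam := by
      have e : (2 * Real.sqrt cw2 + cw2) * lam = 2 * (Real.sqrt cw2 * lam) + cw2 * lam := by ring
      have e2 : 2 * w = 2 * (Real.sqrt cw2 * lam) := by rw [hwdef]
      rw [e, hw2', e2]; linarith [hl2]
    have h0 : 0 ≤ μk - μn := by linarith
    have h2w0 : 0 ≤ 2 * w + w ^ 2 := by positivity
    calc (μk - μn) * (2 * w + w ^ 2) ≤ (Cg * lam * μk) * ((2 * Real.sqrt cw2 + cw2) * lam) :=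
          mul_le_mul hμkn h2w h2w0 (by positivity)
      _ = Cg * (2 * Real.sqrt cw2 + cw2) * lam ^ 2 * μk := by ring
  have hterm3 : 7 * (crossBound 1 B (1 / 2) * CW ^ 2) ≤ CW ^ 2 / 2 * lam ^ 2 * μk := by
    have h1 : lam ^ 2 * μ0 ≤ lam ^ 2 * (2 * μk) := mul_le_mul_of_nonneg_left (by linarith) (sq_nonneg lam)
    have h2 : 7 * crossBound 1 B (1 / 2) ≤ lam ^ 2 * μk / 2 := by linarith
    have h3 := mul_le_mul_of_nonneg_right h2 (sq_nonneg CW)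
    have e : CW ^ 2 / 2 * lam ^ 2 * μk = lam ^ 2 * μk / 2 * CW ^ 2 := by ring
    rw [e]; linarith
  have hq : q ≤ (1 + C * lam ^ 2) * (μk * N) := by
    have h1 : q ≤ (μk + 2 * μn * V + (μk - μn) * (2 * w + w ^ 2)) * N + 7 * (crossBound 1 B (1 / 2) * CW ^ 2) * N := by linarith [h8q]
    have h2 : (μk + 2 * μn * V + (μk - μn) * (2 * w + w ^ 2)) * N ≤ (μk + 2 * cV * lam ^ 2 * μk + Cg * (2 * Real.sqrt cw2 + cw2) * lam ^ 2 * μk) * N :=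
      mul_le_mul_of_nonneg_right (by linarith [hterm1, hterm2]) hN0
    have h3 : 7 * (crossBound 1 B (1 / 2) * CW ^ 2) * N ≤ CW ^ 2 / 2 * lam ^ 2 * μk * N := mul_le_mul_of_nonneg_right hterm3 hN0
    have h4 : (μk + 2 * cV * lam ^ 2 * μk + Cg * (2 * Real.sqrt cw2 + cw2) * lam ^ 2 * μk) * N + CW ^ 2 / 2 * lam ^ 2 * μk * N = (1 + C * lam ^ 2) * (μk * N) := by
      rw [hCdef]; ring
    linarith [h1, h2, h3, h4]
  have hfin : q ≤ Real.exp (C * lam ^ 2) * (μk * N) :=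
    hq.trans (mul_le_mul_of_nonneg_right (by have := Real.add_one_le_exp (C * lam ^ 2); linarith) (mul_nonneg hμkpos.le hN0))
  calc q * μ0 ≤ Real.exp (C * lam ^ 2) * (μk * N) * μ0 := mul_le_mul_of_nonneg_right hfin hμ0.le
    _ = Real.exp (C * lam ^ 2) * μk * μ0 * N := by ring

end Summit.QuantumFields.YangMills.Theorems.FemtoTransferGap.RateTube

end
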